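import Summits.ABC.ABC.Theorems.IsogenyGlueCongruenceEllipticGluingPrimeBoundStubRationalPartReductionAux
import HarnessLib

/-!
# Crux `EllipticGluingPrimeBound`, line Sketch — stub `stub_rationalPartReduction` ((R)), file 2/2

Stub `stub_rationalPartReduction` (the rational-part reduction (R) of the isotypic branch) of line
`Sketch` (isotypic–Minkowski reduction) of crux U
`Summit.ABC.ABC.Theses.IsogenyGlueCongruence.EllipticGluingPrimeBound` (stmt-ABC-13919); helpers in
file 1/2 `…StubRationalPartReductionAux`.

**Statement.** `W/ℚ` elliptic with AV-model `E` (`e : E(ℚ̄) ≃+ W(ℚ̄)` equivariant), `B/ℚ`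
geometrically `E`-isotypic, `ℓ` a prime with `W[ℓ]` irreducible with scalar commutant, `(E, B)`
glued at `ℓ`; then some geometrically `E`-isotypic `A/ℚ` with `dim A + 1 ≤ dim B` and
`Hom_ℚ(E, A) = 0` carries `W[ℓ] ↪ A(ℚ̄)` `Γ_ℚ`-equivariantly.
**Proof.** `Hom_ℚ(E, B)` is free of rank `r ≥ 1` (`module_free_hom_holds`) with basis `(α_a)`;
`ev = Σ_a π_a ≫ α_a : E^r → B` (`exists_biprodPower`), `B₁ = im ev`, `i = (im ev ↪ B)`; a rational
quasi-retraction `i ≫ q = M • 𝟙` (`exists_rational_quasiRetraction`, Poincaré over `ℚ̄` + Galois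
averaging) gives a complement `(i, j) : B₁ ⊞ B₂ → B` (`exists_isIsogeny_desc_of_quasiRetraction`).
KEY STEP (`eq_zero_of_eval_eq_zero`, `exists_multiplier_not_dvd`): `ker ev` meets `E^r[ℓ]`
trivially — a non-zero stable subgroup of `W[ℓ]^r` contains a line `(n_a • Q)_a` with
`n_{a₀} ≡ 1` (`exists_smul_line_le_of_stable'`), and `Σ n_a α_a` would kill `E[ℓ]`, i.e. lie in
`ℓ · Hom_ℚ(E, B)` (`exists_eq_nsmul_of_forall_geomTorsion`), forcing `ℓ ∣ n_{a₀}` — so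
`t : E^r ↠ B₁` is an isogeny (point count `#X[ℓ] = ℓ^{2 dim X}`) whose quasi-inverse, divided by
its `ℓ`-part, yields a multiplier of `(E, B₁)` prime to `ℓ`. The landed Case-B engine `stub_caseB`
then gives an isogeny `h : B₂ → A` with `W[ℓ] ↪ A(ℚ̄)`; `dim A = dim B − dim B₁ ≤ dim B − 1`, `A` is
geometrically isotypic as a quotient of `B_ℚ̄`, and `Hom_ℚ(E, A) = 0` because every `E → B₂`
vanishes (`(γ ≫ t, −g₀) ≫ (i, j) = 0` after expanding `g₀ ≫ j` in the basis, and `(i, j)` has a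
quasi-inverse) while `Hom` is torsion-free. Everything is proved (axioms `propext`,
`Classical.choice`, `Quot.sound`); no `def`, no named fact. References: D. Mumford, *Abelian
Varieties* (1970), §19; J. S. Milne, *Abelian Varieties* (1986), Prop. 12.1, Lemma 12.6.
-/

noncomputable section

-- `Summit.<Summit>.<Problem>` is the mandated summit-side namespace (CONVENTIONS §2); for the
-- single-conjunct summit `ABC` the two coincide, so the duplicate `ABC.ABC` is deliberate.
set_option linter.dupNamespace false

namespace Summit.ABC.ABC.Theorems.IsotypicMinkowski

open CategoryTheory CategoryTheory.Limits AlgebraicGeometry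
open Literature.AlgebraicGeometry.Motives
open Summit.ABC.ABC.Theses.IsogenyGlueCongruence
open Literature.AlgebraicGeometry.Motives.AbelianVariety

/-- `ι_a ≫ ev = α_a` for `ev = Σ_c π_c ≫ α_c` (biproduct identities). -/
private theorem comp_eval_eq {E B P : AbelianVariety.{0} ℚ} {r : ℕ} (α : Fin r → (E ⟶ B))
    (π : Fin r → (P ⟶ E)) (ι : Fin r → (E ⟶ P)) (h1 : ∀ a, ι a ≫ π a = 𝟙 E)
    (h2 : ∀ a c, a ≠ c → ι a ≫ π c = 0) (a : Fin r) : ι a ≫ (∑ c, π c ≫ α c) = α a := by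
  rw [Preadditive.comp_sum, Finset.sum_eq_single a (fun c _ hc ↦ by
    rw [← Category.assoc, h2 a c (Ne.symm hc), zero_comp]) (fun h ↦ absurd (Finset.mem_univ a) h),
    ← Category.assoc, h1, Category.id_comp]

/-- `(Σ_a n_a • f_a)(x) = Σ_a n_a • f_a(x)` on geometric points (additivity of `f ↦ f(ℚ̄)`). -/
private theorem geomPointsMap_sum_zsmul {X Y : AbelianVariety.{0} ℚ} {r : ℕ} (n : Fin r → ℤ)
    (f : Fin r → (X ⟶ Y)) (x : X.geomPoints) :
    AbelianVariety.Hom.geomPointsMap (∑ a, n a • f a) x =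
      ∑ a, n a • AbelianVariety.Hom.geomPointsMap (f a) x := by
  rw [← AbelianVariety.Hom.geomPointsMapAddMonoidHom_apply, map_sum, AddMonoidHom.finsetSum_apply]
  refine Finset.sum_congr rfl fun a _ ↦ ?_
  rw [map_zsmul, AddMonoidHom.zsmul_apply, AbelianVariety.Hom.geomPointsMapAddMonoidHom_apply]

/-- In an `ℓ`-power-torsion situation a non-zero element has a non-zero multiple killed by `ℓ`:
if `v ≠ 0` and `ℓᵃ • v = 0` then some `w = ℓᵏ • v ≠ 0` has `ℓ • w = 0`. -/
private theorem exists_pow_smul_ne_zero' {M : Type*} [AddCommGroup M] {ℓ a : ℕ} {v : M}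
    (hv : v ≠ 0) (ha : (ℓ ^ a : ℤ) • v = 0) :
    ∃ k : ℕ, (ℓ ^ k : ℤ) • v ≠ 0 ∧ (ℓ : ℤ) • ((ℓ ^ k : ℤ) • v) = 0 := by
  classical
  have hex : ∃ k : ℕ, (ℓ ^ k : ℤ) • v = 0 := ⟨a, ha⟩
  obtain ⟨k, hk⟩ := Nat.exists_eq_succ_of_ne_zero (show Nat.find hex ≠ 0 from fun h0 ↦
    hv (by simpa [h0] using Nat.find_spec hex))
  have h := Nat.find_spec hex
  rw [hk, pow_succ', mul_smul] at h
  exact ⟨k, Nat.find_min hex (by omega), h⟩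

/-- **The kernel of `ev : E^r → B` meets `E^r[ℓ]` trivially** for a `ℤ`-basis `(α_a)` of
`Hom_ℚ(E, B)` and `W[ℓ]` irreducible with scalar commutant: the `Γ_ℚ`-stable subgroup
`D = {d ∈ W[ℓ]^r : ev (Σ_a ι_a e⁻¹(d_a)) = 0}`, if non-zero, contains a line `(n_a • Q)_a` with
`n_{a₀}` acting as the identity, so `φ = Σ n_a α_a` kills `E[ℓ]`, `φ = ℓ • φ'`, `ℓ ∣ n_{a₀}`
(coordinates), and `Q = n_{a₀} • Q = 0` on `W[ℓ] ≠ 0` — absurd; so `D = ⊥`, and `x ∈ E^r[ℓ]` with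
`ev x = 0` has coordinates in `D`, i.e. `x = Σ ι_a π_a x = 0`. -/
private theorem eq_zero_of_eval_eq_zero {W : WeierstrassCurve ℚ} [W.IsElliptic]
    {E B P : AbelianVariety.{0} ℚ} (e : E.geomPoints ≃+ W.geomPoints)
    (he : ∀ (σ : Field.absoluteGaloisGroup ℚ) (Q : E.geomPoints), e (σ • Q) = σ • e Q)
    {ℓ : ℕ} (hℓ : ℓ.Prime) (hirr : W.HasIrreducibleModPGaloisRep ℓ)
    (hsc : ∀ f : W.geomTorsion ℓ →+ W.geomTorsion ℓ,
      (∀ (σ : Field.absoluteGaloisGroup ℚ) (Q : W.geomTorsion ℓ), f (σ • Q) = σ • f Q) →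
      ∃ n : ℤ, ∀ Q : W.geomTorsion ℓ, f Q = n • Q)
    {r : ℕ} (b : Module.Basis (Fin r) ℤ (E ⟶ B)) (π : Fin r → (P ⟶ E)) (ι : Fin r → (E ⟶ P))
    (h1 : ∀ a, ι a ≫ π a = 𝟙 E) (h2 : ∀ a c, a ≠ c → ι a ≫ π c = 0)
    (h3 : ∑ a, π a ≫ ι a = 𝟙 P) {x : P.geomPoints}
    (hx : AbelianVariety.Hom.geomPointsMap (∑ a, π a ≫ b a) x = 0)
    (hxℓ : x ∈ P.geomTorsion ℓ) : x = 0 := by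
  classical
  have hιev := comp_eval_eq b π ι h1 h2
  have hcardV : Nat.card (W.geomTorsion ℓ) = ℓ ^ 2 := by
    rw [Literature.NumberTheory.EllipticCurves.natCard_geomTorsion_int_eq_sq W
      (by exact_mod_cast hℓ.ne_zero), Int.natAbs_natCast]
  haveI : Finite (W.geomTorsion ℓ) :=
    Nat.finite_of_card_ne_zero (by rw [hcardV]; exact pow_ne_zero 2 hℓ.ne_zero)
  have hes : ∀ (σ : Field.absoluteGaloisGroup ℚ) (Q : W.geomPoints),
      e.symm (σ • Q) = σ • e.symm Q := fun σ Q ↦ by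
    apply e.injective
    rw [he, e.apply_symm_apply, e.apply_symm_apply]
  -- `Φ : W[ℓ]^r → E^r(ℚ̄)`, `d ↦ Σ_a ι_a (e⁻¹ (d_a))`, and the stable subgroup `D = Φ⁻¹ (ker ev)`
  let Φ : (Fin r → W.geomTorsion ℓ) →+ P.geomPoints :=
    ∑ a, (AbelianVariety.Hom.geomPointsMap (ι a)).comp (e.symm.toAddMonoidHom.comp
      ((W.geomTorsion ℓ).subtype.comp
        (Pi.evalAddMonoidHom (fun _ : Fin r ↦ ↥(W.geomTorsion (ℓ : ℤ))) a)))
  have hΦ : ∀ d, Φ d = ∑ a, AbelianVariety.Hom.geomPointsMap (ι a) (e.symm (d a)) := fun d ↦ by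
    simp only [Φ, AddMonoidHom.finsetSum_apply]
    rfl
  let D : AddSubgroup (Fin r → W.geomTorsion ℓ) :=
    (AbelianVariety.Hom.geomPointsMap (∑ a, π a ≫ b a)).ker.comap Φ
  have hDmem : ∀ d, d ∈ D ↔ AbelianVariety.Hom.geomPointsMap (∑ a, π a ≫ b a) (Φ d) = 0 :=
    fun d ↦ Iff.rfl
  have hΦσ : ∀ (σ : Field.absoluteGaloisGroup ℚ) (d : Fin r → W.geomTorsion ℓ),
      Φ (σ • d) = σ • Φ d := by
    intro σ d
    rw [hΦ, hΦ, Finset.smul_sum]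
    refine Finset.sum_congr rfl fun a _ ↦ ?_
    rw [Pi.smul_apply, Literature.NumberTheory.EllipticCurves.AddSubgroup.torsionBy.coe_smul, hes,
      AbelianVariety.Hom.geomPointsMap_smul]
  have hDst : ∀ (σ : Field.absoluteGaloisGroup ℚ) (d : Fin r → W.geomTorsion ℓ),
      d ∈ D → σ • d ∈ D := by
    intro σ d hd
    rw [hDmem] at hd ⊢
    rw [hΦσ, AbelianVariety.Hom.geomPointsMap_smul, hd, smul_zero]
  have hDbot : D = ⊥ := by
    by_contra hD0
    obtain ⟨n, a₀, hn1, hline⟩ :=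
      exists_smul_line_le_of_stable' (Γ := Field.absoluteGaloisGroup ℚ) hirr hsc D hDst hD0
    have hkill : ∀ P₀ ∈ E.geomTorsion (ℓ : ℕ),
        AbelianVariety.Hom.geomPointsMap (∑ a, n a • b a) P₀ = 0 := by
      intro P₀ hP₀
      have hQ : e P₀ ∈ W.geomTorsion ℓ := (map_mem_geomTorsion_iff e ℓ P₀).2 hP₀
      have hmem := (hDmem _).1 (hline ⟨e P₀, hQ⟩)
      rw [hΦ, map_sum] at hmem
      rw [geomPointsMap_sum_zsmul, ← hmem]
      refine Finset.sum_congr rfl fun a _ ↦ ?_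
      rw [AddSubgroupClass.coe_zsmul]
      change _ = AbelianVariety.Hom.geomPointsMap _
        (AbelianVariety.Hom.geomPointsMap (ι a) (e.symm (n a • e P₀)))
      rw [← map_zsmul e, e.symm_apply_apply, map_zsmul, map_zsmul, ← AddMonoidHom.comp_apply,
        ← AbelianVariety.Hom.geomPointsMap_comp, hιev]
    obtain ⟨φ', hφ'⟩ := AbelianVariety.exists_eq_nsmul_of_forall_geomTorsion ℓ
      (by exact_mod_cast hℓ.ne_zero) (∑ a, n a • b a) hkill
    have hc := congrFun (b.repr_sum_self n) a₀
    rw [hφ', map_zsmul, Finsupp.coe_smul, Pi.smul_apply, smul_eq_mul] at hc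
    haveI : Nontrivial (W.geomTorsion ℓ) := by
      rw [← Finite.one_lt_card_iff_nontrivial, hcardV]
      exact Nat.one_lt_pow two_ne_zero hℓ.one_lt
    obtain ⟨Q, hQ0⟩ := exists_ne (0 : W.geomTorsion ℓ)
    have hQℓ : (ℓ : ℤ) • Q = 0 :=
      Subtype.ext (by rw [AddSubgroupClass.coe_zsmul]; exact (Submodule.mem_torsionBy_iff _ _).1 Q.2)
    apply hQ0
    rw [← hn1 Q, ← hc, mul_comm, mul_smul, hQℓ, smul_zero]
  -- the coordinates of `x` lie in `D = ⊥`
  have hxa : ∀ a, AbelianVariety.Hom.geomPointsMap (π a) x ∈ E.geomTorsion ℓ := fun a ↦ by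
    rw [AbelianVariety.mem_geomTorsion_iff'] at hxℓ ⊢
    rw [← map_zsmul, hxℓ, map_zero]
  let d : Fin r → W.geomTorsion ℓ := fun a ↦
    ⟨e (AbelianVariety.Hom.geomPointsMap (π a) x), (map_mem_geomTorsion_iff e ℓ _).2 (hxa a)⟩
  have hΦd : Φ d = x := by
    rw [hΦ]
    calc ∑ a, AbelianVariety.Hom.geomPointsMap (ι a) (e.symm (d a))
        = ∑ a, AbelianVariety.Hom.geomPointsMap (π a ≫ ι a) x := by
          refine Finset.sum_congr rfl fun a _ ↦ ?_
          change AbelianVariety.Hom.geomPointsMap (ι a)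
            (e.symm (e (AbelianVariety.Hom.geomPointsMap (π a) x))) = _
          rw [e.symm_apply_apply, AbelianVariety.Hom.geomPointsMap_comp, AddMonoidHom.comp_apply]
      _ = AbelianVariety.Hom.geomPointsMap (∑ a, π a ≫ ι a) x := by
          rw [← AbelianVariety.Hom.geomPointsMapAddMonoidHom_apply, map_sum,
            AddMonoidHom.finsetSum_apply]
          rfl
      _ = x := by rw [h3, AbelianVariety.Hom.geomPointsMap_id, AddMonoidHom.id_apply]
  have hdD : d ∈ D := by rw [hDmem, hΦd, hx]
  rw [hDbot, AddSubgroup.mem_bot] at hdD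
  rw [← hΦd, hdD, map_zero]

/-- **A multiplier of `(E, im ev)` prime to `ℓ`.** `t = (E^r ↠ im ev)` is injective on `E^r[ℓ]`
(`eq_zero_of_eval_eq_zero`), so `#E^r[ℓ] ≤ #(im ev)[ℓ]`, `dim E^r ≤ dim (im ev)` and `t` is an
isogeny; a quasi-inverse `s` (`t ≫ s = k • 𝟙`, `k = ℓᵃ k'`, `ℓ ∤ k'`) kills `(im ev)[ℓᵃ]` (points of
`ker t(ℚ̄)` are killed by `k` and have no `ℓ`-torsion, hence are killed by `k'`), so `s = ℓᵃ • s'`,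
`t ≫ s' = k' • 𝟙` and `(ι_{a₀} ≫ t) ≫ (s' ≫ π_{a₀}) = k' • 𝟙_E`. -/
private theorem exists_multiplier_not_dvd {W : WeierstrassCurve ℚ} [W.IsElliptic]
    {E B P : AbelianVariety.{0} ℚ} (e : E.geomPoints ≃+ W.geomPoints)
    (he : ∀ (σ : Field.absoluteGaloisGroup ℚ) (Q : E.geomPoints), e (σ • Q) = σ • e Q)
    {ℓ : ℕ} (hℓ : ℓ.Prime) (hirr : W.HasIrreducibleModPGaloisRep ℓ)
    (hsc : ∀ f : W.geomTorsion ℓ →+ W.geomTorsion ℓ,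
      (∀ (σ : Field.absoluteGaloisGroup ℚ) (Q : W.geomTorsion ℓ), f (σ • Q) = σ • f Q) →
      ∃ n : ℤ, ∀ Q : W.geomTorsion ℓ, f Q = n • Q)
    {r : ℕ} (b : Module.Basis (Fin r) ℤ (E ⟶ B)) (π : Fin r → (P ⟶ E)) (ι : Fin r → (E ⟶ P))
    (h1 : ∀ a, ι a ≫ π a = 𝟙 E) (h2 : ∀ a c, a ≠ c → ι a ≫ π c = 0)
    (h3 : ∑ a, π a ≫ ι a = 𝟙 P) (a₀ : Fin r) :
    ∃ (β₀ : image (∑ a, π a ≫ b a) ⟶ E) (m : ℤ),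
      (ι a₀ ≫ toImage (∑ a, π a ≫ b a)) ≫ β₀ = m • 𝟙 E ∧ ¬ (ℓ : ℤ) ∣ m := by
  classical
  set ev := ∑ a, π a ≫ b a with hev
  set t := toImage ev with ht
  have hK : ∀ x : P.geomPoints, AbelianVariety.Hom.geomPointsMap t x = 0 →
      x ∈ P.geomTorsion ℓ → x = 0 := by
    intro x hx hxℓ
    refine eq_zero_of_eval_eq_zero e he hℓ hirr hsc b π ι h1 h2 h3 ?_ hxℓ
    rw [← hev, ← toImage_imageι ev, AbelianVariety.Hom.geomPointsMap_comp, AddMonoidHom.comp_apply,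
      ← ht, hx, map_zero]
  -- `t` is injective on `E^r[ℓ]`, so `dim E^r ≤ dim (im ev)` and `t` is an isogeny
  have hℓQ : ((ℓ : ℤ) : ℚ) ≠ 0 := by exact_mod_cast hℓ.ne_zero
  have hcardP := P.natCard_geomTorsion (natCard_torsionPoints_of_isAlgClosed_holds P _) ℓ hℓQ
  have hcardB := (image ev).natCard_geomTorsion
    (natCard_torsionPoints_of_isAlgClosed_holds _ _) ℓ hℓQ
  rw [Int.natAbs_natCast] at hcardP hcardB
  haveI : Finite ((image ev).geomTorsion ℓ) :=
    Nat.finite_of_card_ne_zero (by rw [hcardB]; exact pow_ne_zero _ hℓ.ne_zero)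
  have hdim : P.dim ≤ (image ev).dim := by
    let f : P.geomTorsion ℓ → (image ev).geomTorsion ℓ := fun x ↦
      ⟨AbelianVariety.Hom.geomPointsMap t x, by
        have hx2 := x.2
        rw [AbelianVariety.mem_geomTorsion_iff'] at hx2 ⊢
        rw [← map_zsmul, hx2, map_zero]⟩
    have hf : Function.Injective f := by
      intro x y hxy
      have h := congrArg Subtype.val hxy
      change AbelianVariety.Hom.geomPointsMap t x = AbelianVariety.Hom.geomPointsMap t y at h
      have h0 := hK ((x : P.geomPoints) - y) (by rw [map_sub, h, sub_self])
        ((P.geomTorsion ℓ).sub_mem x.2 y.2)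
      exact Subtype.ext (sub_eq_zero.1 h0)
    have hle := Nat.card_le_card_of_injective f hf
    rw [hcardP, hcardB] at hle
    have h4 := (Nat.pow_le_pow_iff_right hℓ.one_lt).1 hle
    omega
  have htiso : IsIsogeny t :=
    isIsogeny_of_surjective_of_dim_eq t (le_antisymm hdim (dim_le_of_surjective t))
  obtain ⟨s, k, hk, hts, -⟩ := IsIsogeny.exists_nsmul_inverse_holds htiso
  obtain ⟨a, k', hk'ℓ, hkk'⟩ := Nat.exists_eq_pow_mul_and_not_dvd hk.ne' ℓ hℓ.ne_one
  have hkcast : (ℓ : ℤ) ^ a * (k' : ℤ) = (k : ℤ) := by rw [hkk']; push_cast; ring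
  -- every point of `ker t(ℚ̄)` is killed by `k'`
  have hker : ∀ z : P.geomPoints, AbelianVariety.Hom.geomPointsMap t z = 0 → (k' : ℤ) • z = 0 := by
    intro z hz
    have hkz : (k : ℤ) • z = 0 := by
      have h : AbelianVariety.Hom.geomPointsMap (t ≫ s) z = 0 := by
        rw [AbelianVariety.Hom.geomPointsMap_comp, AddMonoidHom.comp_apply, hz, map_zero]
      rwa [hts, geomPointsMap_nsmul_apply, AbelianVariety.Hom.geomPointsMap_id,
        AddMonoidHom.id_apply, ← natCast_zsmul] at h
    by_contra hne
    have ha' : ((ℓ : ℤ) ^ a) • ((k' : ℤ) • z) = 0 := by rw [smul_smul, hkcast, hkz]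
    obtain ⟨j, hj, hjℓ⟩ := exists_pow_smul_ne_zero' hne ha'
    refine hj (hK _ ?_ ((AbelianVariety.mem_geomTorsion_iff' _).2 hjℓ))
    rw [map_zsmul, map_zsmul, hz, smul_zero, smul_zero]
  -- `s` kills `(im ev)[ℓᵃ]`, hence `s = ℓᵃ • s'` and `t ≫ s' = k' • 𝟙`
  have hℓaQ : ((ℓ ^ a : ℕ) : ℚ) ≠ 0 := by exact_mod_cast pow_ne_zero a hℓ.ne_zero
  have hkill : ∀ y ∈ (image ev).geomTorsion ((ℓ ^ a : ℕ) : ℕ),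
      AbelianVariety.Hom.geomPointsMap s y = 0 := by
    intro y hy
    obtain ⟨x, rfl⟩ := htiso.geomPointsMap_surjective y
    have hsx : AbelianVariety.Hom.geomPointsMap s (AbelianVariety.Hom.geomPointsMap t x) =
        (k : ℤ) • x := by
      rw [← AddMonoidHom.comp_apply, ← AbelianVariety.Hom.geomPointsMap_comp, hts,
        geomPointsMap_nsmul_apply, AbelianVariety.Hom.geomPointsMap_id, AddMonoidHom.id_apply,
        natCast_zsmul]
    rw [hsx]
    have hx' : AbelianVariety.Hom.geomPointsMap t (((ℓ ^ a : ℕ) : ℤ) • x) = 0 := by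
      rw [map_zsmul]
      exact (AbelianVariety.mem_geomTorsion_iff' _).1 hy
    have h5 := hker _ hx'
    rw [smul_smul] at h5
    rw [← hkcast, mul_comm]
    exact_mod_cast h5
  obtain ⟨s', hs'⟩ := AbelianVariety.exists_eq_nsmul_of_forall_geomTorsion (ℓ ^ a) hℓaQ s hkill
  have hts' : t ≫ s' = (k' : ℤ) • 𝟙 P := by
    have h : ((ℓ ^ a : ℕ) : ℤ) • (t ≫ s' - (k' : ℤ) • 𝟙 P) = 0 := by
      rw [smul_sub, ← Preadditive.comp_zsmul, ← hs', hts, smul_smul, ← natCast_zsmul, hkk',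
        Nat.cast_mul, sub_self]
    exact sub_eq_zero.1 (eq_zero_of_zsmul_eq_zero_of_cast_ne_zero (by exact_mod_cast hℓaQ) h)
  refine ⟨s' ≫ π a₀, k', ?_, fun h ↦ hk'ℓ (Int.natCast_dvd_natCast.1 h)⟩
  rw [Category.assoc, reassoc_of% hts', Preadditive.zsmul_comp, Category.id_comp,
    Preadditive.comp_zsmul, h1]

/-! ### The stub -/

/-- STUB `stub_rationalPartReduction` ((R), rational-part reduction) of line `Sketch`, PROVED: a
glued geometrically-`E`-isotypic pair `(E, B)` at a prime `ℓ` with `W[ℓ]` irreducible with scalar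
commutant yields a `ℚ`-free geometrically-`E`-isotypic `A/ℚ`, `dim A + 1 ≤ dim B`, carrying
`W[ℓ] ↪ A(ℚ̄)` equivariantly: basis `(α_a)` of `Hom_ℚ(E, B)` (rank `r ≥ 1`), `ev : E^r → B`,
`B₁ = im ev`, rational complement `(i, j) : B₁ ⊞ B₂ → B`, a multiplier of `(E, B₁)` prime to `ℓ`
(`exists_multiplier_not_dvd`), the Case-B engine `stub_caseB` (`h : B₂ → A` an isogeny,
`W[ℓ] ↪ A(ℚ̄)`); `dim A = dim B − dim B₁ ≤ dim B − 1`, `A` is a quotient of `B_ℚ̄` (isotypic), and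
`Hom_ℚ(E, A) = 0` since every `E → B₂` vanishes (`(γ ≫ t, −g₀) ≫ (i, j) = 0` after expanding
`g₀ ≫ j` in the basis) and `Hom` is torsion-free. See the module docstring. -/
theorem stub_rationalPartReduction {W : WeierstrassCurve ℚ} [W.IsElliptic]
    {E B : AbelianVariety.{0} ℚ} (e : E.geomPoints ≃+ W.geomPoints)
    (he : ∀ (σ : Field.absoluteGaloisGroup ℚ) (P : E.geomPoints), e (σ • P) = σ • e P)
    (hiso : ∀ (C : AbelianVariety.{0} (AlgebraicClosure ℚ))
      (g : B.baseChange (AlgebraicClosure ℚ) ⟶ C),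
      Surjective (AbelianVariety.Hom.toSchemeHom g) → C.dim ≠ 0 →
      ∃ f : E.baseChange (AlgebraicClosure ℚ) ⟶ C, f ≠ 0)
    {ℓ : ℕ} (hℓ : ℓ.Prime) (hirr : W.HasIrreducibleModPGaloisRep ℓ)
    (hsc : ∀ f : W.geomTorsion ℓ →+ W.geomTorsion ℓ,
      (∀ (σ : Field.absoluteGaloisGroup ℚ) (P : W.geomTorsion ℓ), f (σ • P) = σ • f P) →
      ∃ n : ℤ, ∀ P : W.geomTorsion ℓ, f P = n • P)
    (hex : ∃ (α : E ⟶ B) (β : B ⟶ E) (n : ℤ), n ≠ 0 ∧ α ≫ β = n • 𝟙 E)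
    (hall : ∀ (α : E ⟶ B) (β : B ⟶ E) (n : ℤ), α ≫ β = n • 𝟙 E → (ℓ : ℤ) ∣ n) :
    ∃ A : AbelianVariety.{0} ℚ, A.dim + 1 ≤ B.dim ∧
      (∀ (C : AbelianVariety.{0} (AlgebraicClosure ℚ))
          (g : A.baseChange (AlgebraicClosure ℚ) ⟶ C),
          Surjective (AbelianVariety.Hom.toSchemeHom g) → C.dim ≠ 0 →
          ∃ f : E.baseChange (AlgebraicClosure ℚ) ⟶ C, f ≠ 0) ∧
      (∀ f : E ⟶ A, f = 0) ∧
      ∃ ι : W.geomTorsion ℓ →+ A.geomPoints, Function.Injective ι ∧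
        ∀ (σ : Field.absoluteGaloisGroup ℚ) (P : W.geomTorsion ℓ), ι (σ • P) = σ • ι P := by
  classical
  -- `Hom_ℚ(E, B)` is free of finite rank `r ≥ 1`, with basis `b`
  haveI : Module.Free ℤ (E ⟶ B) := module_free_hom_holds E B
  haveI : Module.Finite ℤ (E ⟶ B) := module_finite_hom_holds E B
  haveI : Module.IsTorsionFree ℤ (E ⟶ B) := isTorsionFree_int_hom_of_charZero
  obtain ⟨α, β, n, hn, hαβ⟩ := hex
  have hα0 : α ≠ 0 := by
    rintro rfl
    rw [zero_comp] at hαβ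
    exact hn ((EllipticGluingPrimeBound.Negative.zsmul_id_eq_zero_iff e).1 hαβ.symm)
  have hr1 : 0 < Module.finrank ℤ (E ⟶ B) := Module.finrank_pos_iff_exists_ne_zero.2 ⟨α, hα0⟩
  let b : Module.Basis (Fin (Module.finrank ℤ (E ⟶ B))) ℤ (E ⟶ B) := Module.finBasis ℤ (E ⟶ B)
  -- `P = E^r`, `ev = Σ π_a ≫ α_a : P → B`, `B₁ = im ev`, complement `B₂`
  obtain ⟨P, π, ι, h1, h2, h3⟩ := exists_biprodPower E (Nat.one_le_iff_ne_zero.2 hr1.ne')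
  have hιev := comp_eval_eq b π ι h1 h2
  obtain ⟨q, M, hM, hiq⟩ := exists_rational_quasiRetraction (imageι (∑ a, π a ≫ b a))
  obtain ⟨B₂, j, hσ⟩ := exists_isIsogeny_desc_of_quasiRetraction (imageι (∑ a, π a ≫ b a)) q hM hiq
  -- a multiplier of `(E, B₁)` prime to `ℓ`, and the Case-B engine
  obtain ⟨β₀, m, hm, hndvd⟩ := exists_multiplier_not_dvd e he hℓ hirr hsc b π ι h1 h2 h3 ⟨0, hr1⟩
  obtain ⟨A, h, hh, hemb⟩ := stub_caseB e he hℓ (geomTorsion_le_of_stable_of_irreducible e he hirr)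
    hall (imageι (∑ a, π a ≫ b a)) j hσ (ι ⟨0, hr1⟩ ≫ toImage (∑ a, π a ≫ b a)) β₀ m hm hndvd
  obtain ⟨ψ, N, hN, hσψ, -⟩ := IsIsogeny.exists_nsmul_inverse_holds hσ
  obtain ⟨h', c, hc, -, hh'h⟩ := IsIsogeny.exists_nsmul_inverse_holds hh
  refine ⟨A, ?_, ?_, ?_, hemb⟩
  · -- `dim A + 1 ≤ dim B`
    have hB₁ : (image (∑ a, π a ≫ b a)).dim ≠ 0 :=
      EllipticGluingPrimeBound.Negative.dim_ne_zero_of_multiplier e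
        ⟨_, β₀, m, fun h0 ↦ hndvd (by rw [h0]; exact dvd_zero _), hm⟩
    have hdimB : (image (∑ a, π a ≫ b a) ⊞ B₂).dim = B.dim := dim_eq_of_isIsogeny hσ
    rw [dim_biprod] at hdimB
    have hA : B₂.dim = A.dim := dim_eq_of_isIsogenous_holds ⟨h, hh⟩
    omega
  · -- `A` is geometrically `E`-isotypic: a quotient of `B_ℚ̄`
    intro C g hg hC
    haveI := hg
    haveI : Surjective (Hom.toSchemeHom (biprod.desc (imageι (∑ a, π a ≫ b a)) j ≫ ψ)) := by
      rw [hσψ]; exact surjective_nsmul_id _ hN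
    haveI : Surjective (Hom.toSchemeHom ψ) :=
      surjective_of_comp (biprod.desc (imageι (∑ a, π a ≫ b a)) j) ψ
    haveI : Surjective (Hom.toSchemeHom
        ((biprod.inr : B₂ ⟶ image (∑ a, π a ≫ b a) ⊞ B₂) ≫ biprod.snd)) := by
      rw [biprod.inr_snd]; exact (isIsogeny_id B₂).1
    haveI : Surjective (Hom.toSchemeHom (biprod.snd : image (∑ a, π a ≫ b a) ⊞ B₂ ⟶ B₂)) :=
      surjective_of_comp (biprod.inr : B₂ ⟶ image (∑ a, π a ≫ b a) ⊞ B₂) biprod.snd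
    haveI : Surjective (Hom.toSchemeHom h) := hh.1
    haveI : Surjective (Hom.toSchemeHom (ψ ≫ biprod.snd ≫ h)) := by
      change Surjective (Hom.toSchemeHom ψ ≫ Hom.toSchemeHom biprod.snd ≫ Hom.toSchemeHom h)
      infer_instance
    haveI : Surjective (Hom.toSchemeHom
        (Hom.baseChange (AlgebraicClosure ℚ) (ψ ≫ biprod.snd ≫ h))) :=
      surjective_baseChange (AlgebraicClosure ℚ) _
    haveI : Surjective (Hom.toSchemeHom
        (Hom.baseChange (AlgebraicClosure ℚ) (ψ ≫ biprod.snd ≫ h) ≫ g)) := by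
      change Surjective (Hom.toSchemeHom _ ≫ Hom.toSchemeHom g)
      infer_instance
    exact hiso C (Hom.baseChange (AlgebraicClosure ℚ) (ψ ≫ biprod.snd ≫ h) ≫ g) inferInstance hC
  · -- `Hom_ℚ(E, A) = 0`
    intro f
    have hB₂ : ∀ g₀ : E ⟶ B₂, g₀ = 0 := by
      intro g₀
      have hfac : (∑ a, b.repr (g₀ ≫ j) a • ι a) ≫ (∑ a, π a ≫ b a) = g₀ ≫ j := by
        rw [Preadditive.sum_comp]
        simp_rw [Preadditive.zsmul_comp, hιev]
        exact b.sum_repr (g₀ ≫ j)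
      have hzero : biprod.lift ((∑ a, b.repr (g₀ ≫ j) a • ι a) ≫ toImage (∑ a, π a ≫ b a)) (-g₀) ≫
          biprod.desc (imageι (∑ a, π a ≫ b a)) j = 0 := by
        rw [biprod.lift_desc, Category.assoc, toImage_imageι, hfac, Preadditive.neg_comp,
          add_neg_cancel]
      have hL : biprod.lift ((∑ a, b.repr (g₀ ≫ j) a • ι a) ≫ toImage (∑ a, π a ≫ b a)) (-g₀) =
          0 := by
        have h6 := congrArg (· ≫ ψ) hzero
        simp only [Category.assoc, hσψ, zero_comp, Preadditive.comp_nsmul, Category.comp_id] at h6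
        exact eq_zero_of_nsmul_eq_zero_of_cast_ne_zero (by exact_mod_cast hN.ne') h6
      have h7 := congrArg (· ≫ biprod.snd) hL
      simp only [biprod.lift_snd, zero_comp, neg_eq_zero] at h7
      exact h7
    have h0 : f ≫ h' = 0 := hB₂ _
    have h8 : c • f = 0 := by
      rw [← Category.comp_id f, ← Preadditive.comp_nsmul, ← hh'h, ← Category.assoc, h0, zero_comp]
    exact eq_zero_of_nsmul_eq_zero_of_cast_ne_zero (by exact_mod_cast hc.ne') h8

end Summit.ABC.ABC.Theorems.IsotypicMinkowski

end
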